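import Mathlib
import HarnessLib
import Summits.CriticalPhenomena.PercolationContinuityZ3.Theses.PercTorusSliceFilling
import Summits.CriticalPhenomena.PercolationContinuityZ3.Theorems.PercTorusSliceFillingSliceFillingTransportChart
import Literature.Probability.Percolation.ConstrainedClusters
import Literature.Probability.Percolation.SubgraphMonotonicity

/-!
# Route `PercTorusSliceFilling`, item `SliceFillingTransport` (Lemma E of the card, box form)

Closes item `stmt-CriticalPhenomena-5417` of route `CriticalPhenomena/PercTorusSliceFilling`
(`sliceFillingTransport_proof`, whose type is literally the route declaration
`SliceFillingTransport`): for Bernoulli bond percolation on the discrete torus `T_n = (ℤ/nℤ)³`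
(`torusGraph 3 n`) and on `ℤ³` (`zdGraph 3`) at the same parameter `p`, and `n ≥ 4`,
`m = ⌊(n-2)/2⌋`,

`E_{T_n,p}[N_sf] ≤ n³ · E_{ℤ³,p}[ 1{0 ↔ ∂^{in}B(m) in B(m)} / |C^{B(m)}(0)| ]`,

where `N_sf` is the number of slice-filling open clusters of the torus (clusters meeting every
slice `{y_i = t}` in some direction `i`) and `C^{B(m)}(0) = {y | 0 ↔ y in B(m)}` is the box
cluster of the origin.

Proof (the card's; no transitivity of the torus measure is used):
* `N_sf = Σ_x 1{C(x) sf}/|C(x)|` exactly (`ncard_sf_eq_sum`: each slice-filling cluster `S`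
  contributes `Σ_{x ∈ S} 1/|S| = 1`);
* almost surely only torus edges are open (`setBernoulli_ae_subset`); then for each `x`, lift the
  configuration along the chart `a ↦ x + proj a` of the box `B(m)` (chart file
  `PercTorusSliceFillingSliceFillingTransportChart.lean`): a slice-filling `C(x)` leaves the
  projected box (it has only `2m + 1 < n` slices in each direction) through an inner-boundary
  vertex reached inside it, so the lifted configuration has a local arm
  (`locArm_of_sliceFilling`, a closure argument on open paths via `exists_lift_of_adj`), and
  `|C(x)| ≥ |C_loc|` (`ncard_locCluster_le`); hence
  `1{C(x) sf}/|C(x)| ≤ 1{Arm_m}/|Cloc_m|` of the lift (`sfWeight_le_local`);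
* the lift along the chart and the restriction of a `ℤ³` configuration to the box have the same
  law (`map_restrictConfig_chart_eq`) and the `ℤ³` integrand is the local functional of the
  restriction (`integrand_eq_local`), so each of the `n³` terms has expectation
  `E_{ℤ³,p}[1{0 ↔ ∂^{in}B(m) in B(m)} / |C^{B(m)}(0)|]` (`integral_map` twice); all functions
  on the finite configuration spaces are integrable (`Integrable.of_finite`).
-/

noncomputable section

namespace Summit.CriticalPhenomena.PercolationContinuityZ3.Theorems

open MeasureTheory
open Literature.Probability.Percolation Literature.Probability.LatticeModels
open scoped Classical

namespace SliceFillingTransportProof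

/-! ## Torus side: lifting open paths along the chart -/

section Torus

variable {n m : ℕ}

/-- **`|C_loc| ≤ |C(x)|`**: the chart maps the local cluster of the lifted configuration
injectively into the open cluster of `x`. -/
theorem ncard_locCluster_le (hn : 2 * m + 2 ≤ n) [NeZero n] (x : TorusSite 3 n)
    (ω : BondConfig (TorusSite 3 n)) :
    Set.ncard {y : Site 3 | ∃ (h0 : (0 : Site 3) ∈ (box 3 m : Set (Site 3)))
        (hy : y ∈ (box 3 m : Set (Site 3))),
        (openGraph (restrictConfig
          (fun a : (box 3 m : Set (Site 3)) => x + Torus.proj n (a : Site 3)) ω)).Reachable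
          ⟨0, h0⟩ ⟨y, hy⟩} ≤ (openCluster ω x).ncard := by
  refine Set.ncard_le_ncard_of_injOn (fun y : Site 3 => x + Torus.proj n y) ?_ ?_
    (Set.toFinite _)
  · rintro y ⟨h0, hy, hr⟩
    have := reachable_map_of_restrictConfig (chart_injective (by omega) x) ω hr
    have h0' : Torus.proj n (0 : Site 3) = 0 := by ext i; simp [Torus.proj_apply]
    simp only [h0', add_zero] at this
    exact this
  · rintro a ⟨-, ha, -⟩ b ⟨-, hb, -⟩ hab
    exact eq_of_proj_eq (by omega) ha hb (add_left_cancel hab)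

/-- One closure step of the lifting argument: if `a ∈ B(m)` is not an inner-boundary vertex and
`x + proj a ∼ v` is an open TORUS edge, then `v = x + proj b` for a box neighbour `b` of `a`
joined to `a` by an open edge of the lifted configuration. -/
theorem exists_lift_of_adj (x : TorusSite 3 n)
    {ω : BondConfig (TorusSite 3 n)} (hω : ω ⊆ (torusGraph 3 n).edgeSet)
    {a : (box 3 m : Set (Site 3))} (ha : (a : Site 3) ∉ innerBoundary (zdGraph 3) (box 3 m))
    {v : TorusSite 3 n} (hadj : (openGraph ω).Adj (x + Torus.proj n (a : Site 3)) v) :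
    ∃ b : (box 3 m : Set (Site 3)), x + Torus.proj n (b : Site 3) = v ∧
      (openGraph (restrictConfig
        (fun a : (box 3 m : Set (Site 3)) => x + Torus.proj n (a : Site 3)) ω)).Adj a b := by
  rw [openGraph_adj] at hadj
  have hT : (torusGraph 3 n).Adj (x + Torus.proj n (a : Site 3)) v := by
    have := hω hadj.1
    rwa [SimpleGraph.mem_edgeSet] at this
  -- every `ℤ³`-neighbour of `a` lies in the box
  have hnb : ∀ b' : Site 3, (zdGraph 3).Adj (a : Site 3) b' → b' ∈ (box 3 m : Set (Site 3)) := by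
    intro b' hb'
    by_contra hb'box
    apply ha
    rw [mem_innerBoundary_iff]
    exact ⟨a.2, b', hb'box, hb'⟩
  rw [torusGraph_adj_iff] at hT
  obtain ⟨-, ⟨i, hi⟩ | ⟨i, hi⟩⟩ := hT
  · -- `v = (x + proj a) + eᵢ`: lift to `a + eᵢ`
    set b' : Site 3 := (a : Site 3) + Pi.single i 1 with hb'
    have hadjZ : (zdGraph 3).Adj (a : Site 3) b' := (zdGraph_adj_iff _ _).2 ⟨i, Or.inl rfl⟩
    have hv : x + Torus.proj n b' = v := by
      rw [hi, hb', proj_add_site3, proj_single, add_assoc]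
    refine ⟨⟨b', hnb b' hadjZ⟩, hv, ?_⟩
    rw [openGraph_adj, mem_restrictConfig, Sym2.map_mk]
    refine ⟨?_, fun h => hadjZ.ne (congrArg Subtype.val h)⟩
    change s(x + Torus.proj n (a : Site 3), x + Torus.proj n b') ∈ ω
    rw [hv]; exact hadj.1
  · -- `x + proj a = v + eᵢ`: lift to `a - eᵢ`
    set b' : Site 3 := (a : Site 3) - Pi.single i 1 with hb'
    have hab' : (a : Site 3) = b' + Pi.single i 1 := by rw [hb', sub_add_cancel]
    have hadjZ : (zdGraph 3).Adj (a : Site 3) b' := (zdGraph_adj_iff _ _).2 ⟨i, Or.inr hab'⟩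
    have hv : x + Torus.proj n b' = v := by
      have h1 : x + Torus.proj n (a : Site 3) = (x + Torus.proj n b') + Pi.single i 1 := by
        conv_lhs => rw [hab']
        rw [proj_add_site3, proj_single, add_assoc]
      rw [h1] at hi
      exact add_right_cancel hi
    refine ⟨⟨b', hnb b' hadjZ⟩, hv, ?_⟩
    rw [openGraph_adj, mem_restrictConfig, Sym2.map_mk]
    refine ⟨?_, fun h => hadjZ.ne (congrArg Subtype.val h)⟩
    change s(x + Torus.proj n (a : Site 3), x + Torus.proj n b') ∈ ω
    rw [hv]; exact hadj.1

/-- **Slice-filling clusters exit the projected box.** If only torus edges are open and `C(x)`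
meets every slice in some direction, then the lifted configuration has a local arm: `0` is
joined inside `B(m)` to an inner-boundary vertex of `B(m)`. (Otherwise the chart image of the
lifted cluster of `0` is closed under open torus edges, `exists_lift_of_adj`, hence contains
`C(x)`, which then sees at most `2m + 1 < n` slices in every direction.) -/
theorem locArm_of_sliceFilling (hn : 2 * m + 2 ≤ n) [NeZero n] (x : TorusSite 3 n)
    {ω : BondConfig (TorusSite 3 n)} (hω : ω ⊆ (torusGraph 3 n).edgeSet)
    (hsf : ∃ i : Fin 3, ∀ t : ZMod n, ∃ y ∈ openCluster ω x, y i = t) :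
    restrictConfig (fun a : (box 3 m : Set (Site 3)) => x + Torus.proj n (a : Site 3)) ω ∈
      {η : BondConfig (box 3 m : Set (Site 3)) | ∃ y ∈ innerBoundary (zdGraph 3) (box 3 m),
        ∃ (h0 : (0 : Site 3) ∈ (box 3 m : Set (Site 3))) (hy : y ∈ (box 3 m : Set (Site 3))),
          (openGraph η).Reachable ⟨0, h0⟩ ⟨y, hy⟩} := by
  by_contra harm
  set η := restrictConfig (fun a : (box 3 m : Set (Site 3)) => x + Torus.proj n (a : Site 3)) ω
    with hη
  -- the chart image of the lifted cluster of `0` contains `C(x)`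
  have hsub : openCluster ω x ⊆ (fun a : (box 3 m : Set (Site 3)) => x + Torus.proj n (a : Site 3)) ''
      {a | (openGraph η).Reachable ⟨0, zero_mem_boxSet m⟩ a} := by
    intro v hv
    change (openGraph ω).Reachable x v at hv
    rw [SimpleGraph.reachable_iff_reflTransGen] at hv
    induction hv with
    | refl =>
      refine ⟨⟨0, zero_mem_boxSet m⟩, SimpleGraph.Reachable.refl _, ?_⟩
      have h0' : Torus.proj n (0 : Site 3) = 0 := by ext i; simp [Torus.proj_apply]
      simp only [h0', add_zero]
    | tail _ hbc ih =>
      obtain ⟨a, ha, rfl⟩ := ih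
      have hain : (a : Site 3) ∉ innerBoundary (zdGraph 3) (box 3 m) := by
        intro hin
        exact harm ⟨a, hin, zero_mem_boxSet m, a.2, by simpa using ha⟩
      obtain ⟨b, hb, hab⟩ := exists_lift_of_adj x hω hain hbc
      exact ⟨b, SimpleGraph.Reachable.trans ha hab.reachable, hb⟩
  obtain ⟨i, hi⟩ := hsf
  -- every residue is `x i + k (mod n)` for some `k ∈ [-m, m]`: too few residues
  have hcover : (Finset.univ : Finset (ZMod n)) ⊆
      (Finset.Icc (-(m : ℤ)) m).image fun k : ℤ => x i + (k : ZMod n) := by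
    intro t _
    obtain ⟨y, hy, hyt⟩ := hi t
    obtain ⟨a, -, rfl⟩ := hsub hy
    refine Finset.mem_image.2 ⟨(a : Site 3) i, ?_, ?_⟩
    · have := a.2
      rw [Finset.mem_coe, mem_box] at this
      exact Finset.mem_Icc.2 (this i)
    · rw [← hyt]; simp [Torus.proj_apply]
  have hcard := Finset.card_le_card hcover
  rw [Finset.card_univ, ZMod.card] at hcard
  have h2 := hcard.trans Finset.card_image_le
  rw [Int.card_Icc] at h2
  omega

/-- **Pointwise domination** (only torus edges open): the weight `1{C(x) sf} / |C(x)|` of `x` is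
at most the local functional `1{Arm_m} / |Cloc_m|` of the lifted configuration. -/
theorem sfWeight_le_local (hn : 2 * m + 2 ≤ n) [NeZero n] (x : TorusSite 3 n)
    {ω : BondConfig (TorusSite 3 n)} (hω : ω ⊆ (torusGraph 3 n).edgeSet) :
    (if (∃ i : Fin 3, ∀ t : ZMod n, ∃ y ∈ openCluster ω x, y i = t)
      then ((Set.ncard (openCluster ω x) : ℕ) : ℝ)⁻¹ else (0 : ℝ)) ≤
      {η : BondConfig (box 3 m : Set (Site 3)) | ∃ y ∈ innerBoundary (zdGraph 3) (box 3 m),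
          ∃ (h0 : (0 : Site 3) ∈ (box 3 m : Set (Site 3))) (hy : y ∈ (box 3 m : Set (Site 3))),
            (openGraph η).Reachable ⟨0, h0⟩ ⟨y, hy⟩}.indicator
        (fun η => ((Set.ncard {y : Site 3 | ∃ (h0 : (0 : Site 3) ∈ (box 3 m : Set (Site 3)))
          (hy : y ∈ (box 3 m : Set (Site 3))), (openGraph η).Reachable ⟨0, h0⟩ ⟨y, hy⟩} : ℝ))⁻¹)
        (restrictConfig (fun a : (box 3 m : Set (Site 3)) => x + Torus.proj n (a : Site 3)) ω) := by
  split_ifs with hsf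
  · rw [Set.indicator_of_mem (locArm_of_sliceFilling hn x hω hsf)]
    set C : Set (Site 3) := {y : Site 3 | ∃ (h0 : (0 : Site 3) ∈ (box 3 m : Set (Site 3)))
      (hy : y ∈ (box 3 m : Set (Site 3))), (openGraph (restrictConfig
        (fun a : (box 3 m : Set (Site 3)) => x + Torus.proj n (a : Site 3)) ω)).Reachable
          ⟨0, h0⟩ ⟨y, hy⟩} with hC
    have hfin : C.Finite := (box 3 m).finite_toSet.subset fun _ ⟨_, hy, _⟩ => hy
    have h1 : (1 : ℝ) ≤ C.ncard := by
      have : 1 ≤ C.ncard :=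
        (Set.ncard_pos hfin).2 ⟨0, zero_mem_boxSet m, zero_mem_boxSet m, SimpleGraph.Reachable.refl _⟩
      exact_mod_cast this
    have h2 : (C.ncard : ℝ) ≤ (openCluster ω x).ncard := by
      exact_mod_cast ncard_locCluster_le hn x ω
    exact inv_anti₀ (by linarith) h2
  · exact Set.indicator_nonneg (fun _ _ => inv_nonneg.2 (Nat.cast_nonneg _)) _

end Torus

/-! ## The counting identity `N_sf = Σ_x 1{C(x) sf} / |C(x)|` -/

section Counting

variable {n : ℕ}

/-- Open clusters sharing a vertex coincide. -/
theorem openCluster_eq_of_mem {V : Type*} {ω : BondConfig V} {x z : V}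
    (h : x ∈ openCluster ω z) : openCluster ω z = openCluster ω x := by
  ext y
  change (openGraph ω).Reachable z x at h
  exact ⟨fun hy => h.symm.trans hy, fun hy => h.trans hy⟩

/-- **Mass transport on the finite torus**: the number of slice-filling open clusters is
`Σ_x 1{C(x) sf} / |C(x)|` (every slice-filling cluster `S` contributes `Σ_{x ∈ S} 1/|S| = 1`). -/
theorem ncard_sf_eq_sum [NeZero n] (ω : BondConfig (TorusSite 3 n)) :
    (Set.ncard {S : Set (TorusSite 3 n) | (∃ x, S = openCluster ω x) ∧
        ∃ i : Fin 3, ∀ t : ZMod n, ∃ y ∈ S, y i = t} : ℝ) =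
      ∑ x : TorusSite 3 n, (if (∃ i : Fin 3, ∀ t : ZMod n, ∃ y ∈ openCluster ω x, y i = t)
        then ((Set.ncard (openCluster ω x) : ℕ) : ℝ)⁻¹ else (0 : ℝ)) := by
  set P : Set (TorusSite 3 n) → Prop := fun S => (∃ x, S = openCluster ω x) ∧
    ∃ i : Fin 3, ∀ t : ZMod n, ∃ y ∈ S, y i = t with hP
  set 𝒮 : Finset (Set (TorusSite 3 n)) := Finset.univ.filter P with h𝒮
  have hset : {S | P S} = (↑𝒮 : Set (Set (TorusSite 3 n))) := by
    ext S; simp [h𝒮]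
  have hL : Set.ncard {S : Set (TorusSite 3 n) | P S} = 𝒮.card := by
    rw [hset, Set.ncard_coe_finset]
  -- the weight of `x` is the sum over slice-filling clusters `S ∋ x` of `1/|S|`
  have hx : ∀ x : TorusSite 3 n,
      (if (∃ i : Fin 3, ∀ t : ZMod n, ∃ y ∈ openCluster ω x, y i = t)
        then ((Set.ncard (openCluster ω x) : ℕ) : ℝ)⁻¹ else (0 : ℝ)) =
        ∑ S ∈ 𝒮, if x ∈ S then ((S.ncard : ℝ))⁻¹ else 0 := by
    intro x
    rw [← Finset.sum_filter]
    have hfilter : 𝒮.filter (fun S => x ∈ S) =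
        if (∃ i : Fin 3, ∀ t : ZMod n, ∃ y ∈ openCluster ω x, y i = t)
        then {openCluster ω x} else ∅ := by
      ext S
      simp only [h𝒮, Finset.mem_filter, Finset.mem_univ, true_and]
      constructor
      · rintro ⟨⟨⟨z, rfl⟩, hsf⟩, hxS⟩
        have hC : openCluster ω z = openCluster ω x := openCluster_eq_of_mem hxS
        rw [hC] at hsf ⊢
        rw [if_pos hsf]
        exact Finset.mem_singleton_self _
      · intro hS
        split_ifs at hS with hsf
        · rw [Finset.mem_singleton] at hS
          subst hS
          exact ⟨⟨⟨x, rfl⟩, hsf⟩, mem_openCluster_self ω x⟩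
        · exact absurd hS (Finset.notMem_empty _)
    rw [hfilter]
    split_ifs with hsf
    · rw [Finset.sum_singleton]
    · rw [Finset.sum_empty]
  calc (Set.ncard {S : Set (TorusSite 3 n) | P S} : ℝ) = 𝒮.card := by rw [hL]
    _ = ∑ S ∈ 𝒮, (1 : ℝ) := by simp
    _ = ∑ S ∈ 𝒮, ∑ x : TorusSite 3 n, (if x ∈ S then ((S.ncard : ℝ))⁻¹ else 0) := by
        refine Finset.sum_congr rfl fun S hS => ?_
        obtain ⟨⟨z, rfl⟩, -⟩ := (Finset.mem_filter.1 hS).2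
        rw [← Finset.sum_filter, Finset.sum_const, nsmul_eq_mul]
        have hcard : ((Finset.univ.filter (fun x => x ∈ openCluster ω z)).card : ℝ) =
            (openCluster ω z).ncard := by
          rw [← Set.ncard_coe_finset]
          congr 2
          ext y; simp
        have hpos : ((openCluster ω z).ncard : ℝ) ≠ 0 := by
          have : 0 < (openCluster ω z).ncard :=
            (Set.ncard_pos (Set.toFinite _)).2 ⟨z, mem_openCluster_self ω z⟩
          positivity
        rw [hcard, mul_inv_cancel₀ hpos]
    _ = ∑ x : TorusSite 3 n, ∑ S ∈ 𝒮, (if x ∈ S then ((S.ncard : ℝ))⁻¹ else 0) :=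
        Finset.sum_comm
    _ = _ := by simp only [hx]

end Counting

/-! ## Assembly of the inequality -/

/-- **Lemma E of the card (box form).** For all `p` and `n ≥ 4`, with `m = ⌊(n-2)/2⌋`,
`E_{T_n,p}[N_sf] ≤ n³ · E_{ℤ³,p}[1{0 ↔ ∂^{in}B(m) in B(m)} / |C^{B(m)}(0)|]`. -/
theorem integral_ncard_sf_le (p : unitInterval) (n : ℕ) (hn : 4 ≤ n) :
    ∫ ω, (Set.ncard {S : Set (TorusSite 3 n) | (∃ x, S = openCluster ω x) ∧
        ∃ i : Fin 3, ∀ t : ZMod n, ∃ y ∈ S, y i = t} : ℝ)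
        ∂(bondPercolation (torusGraph 3 n) p) ≤
      (n : ℝ) ^ 3 * ∫ ω, (siteToBoundary 3 ((n - 2) / 2)).indicator
        (fun ω => ((Set.ncard {y : Site 3 |
          ω ∈ openConnIn (↑(box 3 ((n - 2) / 2))) 0 y} : ℝ))⁻¹) ω
        ∂(bondPercolation (zdGraph 3) p) := by
  haveI : NeZero n := ⟨by omega⟩
  set m := (n - 2) / 2 with hm
  have hmn : 2 * m + 2 ≤ n := by omega
  set μT := bondPercolation (torusGraph 3 n) p with hμT
  set μZ := bondPercolation (zdGraph 3) p with hμZ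
  -- the local functional `F(η) = 1{Arm_m(η)} / |Cloc_m(η)|` and the lifts along the charts
  set F : BondConfig (box 3 m : Set (Site 3)) → ℝ := fun η =>
    {η : BondConfig (box 3 m : Set (Site 3)) | ∃ y ∈ innerBoundary (zdGraph 3) (box 3 m),
        ∃ (h0 : (0 : Site 3) ∈ (box 3 m : Set (Site 3))) (hy : y ∈ (box 3 m : Set (Site 3))),
          (openGraph η).Reachable ⟨0, h0⟩ ⟨y, hy⟩}.indicator
      (fun η => ((Set.ncard {y : Site 3 | ∃ (h0 : (0 : Site 3) ∈ (box 3 m : Set (Site 3)))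
        (hy : y ∈ (box 3 m : Set (Site 3))), (openGraph η).Reachable ⟨0, h0⟩ ⟨y, hy⟩} : ℝ))⁻¹) η
    with hF
  set L : TorusSite 3 n → BondConfig (TorusSite 3 n) → BondConfig (box 3 m : Set (Site 3)) :=
    fun x => restrictConfig (fun a : (box 3 m : Set (Site 3)) => x + Torus.proj n (a : Site 3))
    with hL
  -- almost surely only torus edges are open
  have hae : ∀ᵐ ω ∂μT, ω ⊆ (torusGraph 3 n).edgeSet := ProbabilityTheory.setBernoulli_ae_subset
  -- pointwise (a.e.) domination of `N_sf` by the sum of the lifted local functionals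
  have hpt : ∀ᵐ ω ∂μT, (Set.ncard {S : Set (TorusSite 3 n) | (∃ x, S = openCluster ω x) ∧
      ∃ i : Fin 3, ∀ t : ZMod n, ∃ y ∈ S, y i = t} : ℝ) ≤ ∑ x : TorusSite 3 n, F (L x ω) := by
    filter_upwards [hae] with ω hω
    rw [ncard_sf_eq_sum]
    exact Finset.sum_le_sum fun x _ => sfWeight_le_local hmn x hω
  -- each lifted local functional has the `ℤ³` expectation (same local law + locality)
  have hint : ∀ x : TorusSite 3 n, ∫ ω, F (L x ω) ∂μT =
      ∫ ω, (siteToBoundary 3 m).indicator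
        (fun ω => ((Set.ncard {y : Site 3 | ω ∈ openConnIn (↑(box 3 m)) 0 y} : ℝ))⁻¹) ω ∂μZ := by
    intro x
    calc ∫ ω, F (L x ω) ∂μT = ∫ η, F η ∂(μT.map (L x)) :=
          (integral_map (measurable_restrictConfig _).aemeasurable
            (measurable_of_finite F).aestronglyMeasurable).symm
      _ = ∫ η, F η ∂(μZ.map (restrictConfig (Subtype.val : (box 3 m : Set (Site 3)) → Site 3))) := by
          rw [hμT, hμZ, hL, map_restrictConfig_chart_eq hmn x p]
      _ = ∫ ω, F (restrictConfig (Subtype.val : (box 3 m : Set (Site 3)) → Site 3) ω) ∂μZ :=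
          integral_map (measurable_restrictConfig _).aemeasurable
            (measurable_of_finite F).aestronglyMeasurable
      _ = _ := by simp only [hF, integrand_eq_local]
  calc ∫ ω, (Set.ncard {S : Set (TorusSite 3 n) | (∃ x, S = openCluster ω x) ∧
        ∃ i : Fin 3, ∀ t : ZMod n, ∃ y ∈ S, y i = t} : ℝ) ∂μT
      ≤ ∫ ω, ∑ x : TorusSite 3 n, F (L x ω) ∂μT :=
        integral_mono_ae Integrable.of_finite Integrable.of_finite hpt
    _ = ∑ x : TorusSite 3 n, ∫ ω, F (L x ω) ∂μT :=
        integral_finsetSum _ (fun x _ => Integrable.of_finite)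
    _ = ∑ x : TorusSite 3 n, ∫ ω, (siteToBoundary 3 m).indicator
          (fun ω => ((Set.ncard {y : Site 3 | ω ∈ openConnIn (↑(box 3 m)) 0 y} : ℝ))⁻¹) ω ∂μZ :=
        Finset.sum_congr rfl (fun x _ => hint x)
    _ = (n : ℝ) ^ 3 * ∫ ω, (siteToBoundary 3 m).indicator
          (fun ω => ((Set.ncard {y : Site 3 | ω ∈ openConnIn (↑(box 3 m)) 0 y} : ℝ))⁻¹) ω ∂μZ := by
        rw [Finset.sum_const, Finset.card_univ, nsmul_eq_mul, Fintype.card_fun, ZMod.card,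
          Fintype.card_fin, Nat.cast_pow]

end SliceFillingTransportProof

/-- **Item `SliceFillingTransport` of route `PercTorusSliceFilling` (Lemma E of the card, box
form), proved**: for all `p` and `n ≥ 4`, with `m = ⌊(n-2)/2⌋`,
`E_{T_n,p}[N_sf] ≤ n³ · E_{ℤ³,p}[1{0 ↔ ∂^{in}B(m) in B(m)} / |C^{B(m)}(0)|]`. The type is literally
the route declaration. -/
theorem sliceFillingTransport_proof :
    Summit.CriticalPhenomena.PercolationContinuityZ3.Theses.PercTorusSliceFilling.SliceFillingTransport := by
  intro p n hn
  exact SliceFillingTransportProof.integral_ncard_sf_le p n hn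

end Summit.CriticalPhenomena.PercolationContinuityZ3.Theorems
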